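import Literature.NumberTheory.EllipticCurves.LambdaAdicSelmerDataOrdinaryProofs
import Literature.NumberTheory.EllipticCurves.AnticyclotomicInertiaAboveP
import Literature.NumberTheory.EllipticCurves.SelmerInertiaProofs
import Mathlib.NumberTheory.Padics.RingHoms
import HarnessLib

/-!
# Bounded residue degrees at a ramified place of a `ℤ_p`-extension, and `f(𝔖_p(K_∞)) ⊆ H¹_{F_𝔮}(K, T_𝔮)` when
# the places above `p` ramify (theorems only)

Topic `NumberTheory/EllipticCurves`; namespaces `Literature.NumberTheory.EllipticCurves.ZpExtension` (§1),
`WeierstrassCurve.LambdaAdicSelmerData` (§2). THEOREMS ONLY (no definition, no named fact, no instance, no `sorry`).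

* §1 `ZpExtension.exists_pow_mul_mem_comap_layerSubgroup_of_apply_ne_one` — if some element of the inertia group `I_{K_v}`
  has non-trivial image in `Gal(K_∞/K) ≃ ℤ_p` (the place `v` RAMIFIES in `K_∞/K`), then the residue degrees of the layers
  `K_n` at the primes above `v` are bounded: there is `N₀ = p^e ≥ 1` (`e` = the valuation of that image) with
  `σ^{N₀} · τ ∈ Γ_{K_v} ∩ Γ_n` for every `n`, every `σ ∈ Γ_{K_v}` and a suitable `τ ∈ I_{K_v}` — the hypothesis `hres` of
  `LambdaAdicSelmerData.nsmul_localization_proj_toEisensteinH1Linear_mem_ordinaryCore` (`LambdaAdicSelmerDataOrdinaryProofs`).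
  (Elementary: `p^e κ(σ) ≡ j · κ(τ₁) (mod p^n)` is solvable in `j ∈ ℕ` since `κ(τ₁) = u p^e`, `u ∈ ℤ_pˣ`; Washington §13.1:
  the decomposition group of a ramified place in `ℤ_p` is open.) [Washington1997]
* §2 `LambdaAdicSelmerData.toEisensteinH1Linear_mem_ordinarySelmer_of_ramified` — the containment
  `f(𝔖_p(K_∞)) ⊆ H¹_{F_𝔮}(K, T_𝔮)` (Howard, *Compos. Math.* 140 (2004), Lemma 2.2.7 / Prop. 2.2.8) for the compact control
  map, with the uniformity hypothesis at `v ∣ p` replaced by «`v` ramifies in `K_∞`» (as every place above `p` does in the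
  anticyclotomic `ℤ_p`-extension of an imaginary quadratic field).

References: L. C. Washington, *Introduction to Cyclotomic Fields* (1997), §13.1 (Prop. 13.2–13.3); B. Howard, *Compos. Math.*
140 (2004), §2.2; R. Greenberg, LNM 1716 (1999), §2. No summit statement is proved here; BSD is not proved by any of this.
-/

noncomputable section

open scoped TensorProduct Topology ContRepresentation Classical NumberField
open Field NumberField IsDedekindDomain
open Literature.NumberTheory.GaloisRepresentations Literature.NumberTheory.EllipticCurves

universe u

/-! ## §1 A ramified place has bounded residue degrees in a `ℤ_p`-extension -/

namespace Literature.NumberTheory.EllipticCurves.ZpExtension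

variable {K : Type u} [Field K] [NumberField K] {p : ℕ} [hp : Fact p.Prime] (κ : ZpExtension K p)

/-- **Bounded residue degrees at a ramified place of a `ℤ_p`-extension.** Let `v` be a finite place and suppose some `τ₁` in
the inertia group `I_{K_v} ≤ Γ_{K_v}` has `κ(τ₁|_{K̄}) ≠ 1` in `Gal(K_∞/K) ≃ ℤ_p` (i.e. `v` ramifies in `K_∞/K`). Write
`κ(τ₁) = u p^e` with `u ∈ ℤ_pˣ`. Then for `N₀ = p^e`, every `n` and every `σ ∈ Γ_{K_v}` there is `τ ∈ I_{K_v}` (a power of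
`τ₁⁻¹`) with `σ^{N₀} τ ∈ Γ_{K_v} ∩ Γ_n`, i.e. `κ(σ^{N₀} τ) ∈ p^n ℤ_p`: the residue degree of `K_n` at the primes above `v` divides
`p^e` for all `n` (the decomposition group of `v` in `ℤ_p` contains the open inertia group `p^e ℤ_p`).
[cite: Washington1997, §13.1 Prop. 13.2–13.3 (ℤ_p-extensions: ramification only above p; open subgroups of ℤ_p)] -/
theorem exists_pow_mul_mem_comap_layerSubgroup_of_apply_ne_one {v : HeightOneSpectrum (𝓞 K)}
    {τ₁ : absoluteGaloisGroup (v.adicCompletion K)} (hτ₁ : τ₁ ∈ absInertia (v.adicCompletion K))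
    (hne : κ (absGaloisRestrict K (v.adicCompletion K) τ₁) ≠ 1) :
    ∃ N₀ : ℕ, 0 < N₀ ∧ ∀ (n : ℕ) (σ : absoluteGaloisGroup (v.adicCompletion K)),
      ∃ τ ∈ absInertia (v.adicCompletion K), σ ^ N₀ * τ ∈ (κ.layerSubgroup n).comap
        ((absGaloisRestrict K (v.adicCompletion K) : absoluteGaloisGroup (v.adicCompletion K) →ₜ* absoluteGaloisGroup K) :
          absoluteGaloisGroup (v.adicCompletion K) →* absoluteGaloisGroup K) := by
  set x : ℤ_[p] := (κ (absGaloisRestrict K (v.adicCompletion K) τ₁)).toAdd with hx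
  have hx0 : x ≠ 0 := fun h ↦ hne (by rw [← ofAdd_toAdd (κ _), ← hx, h, ofAdd_zero])
  set e : ℕ := x.valuation with he
  have hxu : x = (PadicInt.unitCoeff hx0 : ℤ_[p]) * (p : ℤ_[p]) ^ e := PadicInt.unitCoeff_spec hx0
  refine ⟨p ^ e, pow_pos hp.out.pos e, fun n σ ↦ ?_⟩
  set y : ℤ_[p] := (κ (absGaloisRestrict K (v.adicCompletion K) σ)).toAdd with hy
  -- `j ≡ u⁻¹ y (mod p^n)`
  set z : ℤ_[p] := ((PadicInt.unitCoeff hx0)⁻¹ : ℤ_[p]ˣ) * y with hz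
  set j : ℕ := z.appr n with hj
  have hjz : z - j ∈ Ideal.span {(p : ℤ_[p]) ^ n} := PadicInt.appr_spec n z
  refine ⟨(τ₁⁻¹) ^ j, Subgroup.pow_mem _ (Subgroup.inv_mem _ hτ₁) j, ?_⟩
  rw [Subgroup.mem_comap, mem_layerSubgroup]
  -- `κ(σ^{p^e} τ₁^{-j}) = p^e y - j x = u p^e (z - j)`
  have hval : (κ (((absGaloisRestrict K (v.adicCompletion K) : absoluteGaloisGroup (v.adicCompletion K) →ₜ*
      absoluteGaloisGroup K) : absoluteGaloisGroup (v.adicCompletion K) →* absoluteGaloisGroup K)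
        (σ ^ p ^ e * τ₁⁻¹ ^ j))).toAdd = (PadicInt.unitCoeff hx0 : ℤ_[p]) * (p : ℤ_[p]) ^ e * (z - j) := by
    have h1 : κ (((absGaloisRestrict K (v.adicCompletion K) : absoluteGaloisGroup (v.adicCompletion K) →ₜ*
        absoluteGaloisGroup K) : absoluteGaloisGroup (v.adicCompletion K) →* absoluteGaloisGroup K)
          (σ ^ p ^ e * τ₁⁻¹ ^ j)) =
        κ (absGaloisRestrict K (v.adicCompletion K) σ) ^ p ^ e * (κ (absGaloisRestrict K (v.adicCompletion K) τ₁))⁻¹ ^ j := by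
      change κ (absGaloisRestrict K (v.adicCompletion K) (σ ^ p ^ e * τ₁⁻¹ ^ j)) = _
      simp only [map_mul, map_pow, map_inv]
    have hyz : y = (PadicInt.unitCoeff hx0 : ℤ_[p]) * z := by
      rw [hz, ← mul_assoc, Units.mul_inv, one_mul]
    rw [h1, toAdd_mul, toAdd_pow, toAdd_pow, toAdd_inv, ← hy, ← hx, smul_neg, nsmul_eq_mul, nsmul_eq_mul,
      Nat.cast_pow]
    linear_combination (p : ℤ_[p]) ^ e * hyz - (j : ℤ_[p]) * hxu
  rw [hval]
  obtain ⟨c, hc⟩ := Ideal.mem_span_singleton.mp hjz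
  rw [hc]
  exact ⟨(PadicInt.unitCoeff hx0 : ℤ_[p]) * (p : ℤ_[p]) ^ e * c, by ring⟩

/-- **The anticyclotomic `ℤ_p`-extension of an imaginary quadratic field has bounded residue degrees above `p`.** For `K`
imaginary quadratic, `p` odd, `κ` anticyclotomic and `v ∣ p`: every inertia group above `p` contains an element acting
non-trivially on `K_∞` (`exists_mem_inertia_apply_ne_one_of_isAnticyclotomic`, Brink 2007 Cor. 1: the class number is finite),
the local inertia group `I_{K_v}` maps onto it (`exists_mem_inertia_apply_eq_holds`, Neukirch II (9.6)), hence
`exists_pow_mul_mem_comap_layerSubgroup_of_apply_ne_one` applies — the hypothesis `hres` of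
`LambdaAdicSelmerData.nsmul_localization_proj_toEisensteinH1Linear_mem_ordinaryCore` at every `v ∣ p`.
[cite: Brink2007, Cor. 1 (p. 2136) and its proof] [cite: NeukirchANT1999, Ch. II §9 Prop. (9.6)] [cite: Washington1997, §13.1] -/
theorem exists_pow_mul_mem_comap_layerSubgroup_of_isAnticyclotomic {K : Type} [Field K] [NumberField K]
    (κ : ZpExtension K p) (hK : IsImaginaryQuadratic K) (hp2 : p ≠ 2) (hκ : κ.IsAnticyclotomic)
    {v : HeightOneSpectrum (𝓞 K)} (hpv : ((p : ℕ) : 𝓞 K) ∈ v.asIdeal) :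
    ∃ N₀ : ℕ, 0 < N₀ ∧ ∀ (n : ℕ) (σ : absoluteGaloisGroup (v.adicCompletion K)),
      ∃ τ ∈ absInertia (v.adicCompletion K), σ ^ N₀ * τ ∈ (κ.layerSubgroup n).comap
        ((absGaloisRestrict K (v.adicCompletion K) : absoluteGaloisGroup (v.adicCompletion K) →ₜ* absoluteGaloisGroup K) :
          absoluteGaloisGroup (v.adicCompletion K) →* absoluteGaloisGroup K) := by
  obtain ⟨𝔐, h𝔐⟩ := v.localPrimesAbove_nonempty
  obtain ⟨w, hw⟩ := v.exists_spectralValuation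
  obtain ⟨τ, hτ, hne⟩ := exists_mem_inertia_apply_ne_one_of_isAnticyclotomic hK hp2 κ hκ hpv
    (v.primeBelow_mem_primesAbove (ι := closureEmb (K := K) (v.adicCompletion K)) h𝔐)
  obtain ⟨σ, hσ, hστ⟩ := IsDedekindDomain.HeightOneSpectrum.exists_mem_inertia_apply_eq_holds v
    (closureEmb (K := K) (v.adicCompletion K)) h𝔐 hτ
  have hres : resGalOfEmb (closureEmb (K := K) (v.adicCompletion K)) σ = τ := resGalOfEmb_eq_of_apply_eq _ hστ
  refine κ.exists_pow_mul_mem_comap_layerSubgroup_of_apply_ne_one (τ₁ := σ) ?_ ?_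
  · rw [← HeightOneSpectrum.inertia_eq_absInertia hw h𝔐]; exact hσ
  · have hστ' : absGaloisRestrict K (v.adicCompletion K) σ = τ := hres
    rw [hστ']; exact hne

end Literature.NumberTheory.EllipticCurves.ZpExtension

/-! ## §2 `f(𝔖_p(K_∞)) ⊆ H¹_{F_𝔮}(K, T_𝔮)` when the places above `p` ramify; the anticyclotomic case -/

namespace WeierstrassCurve.LambdaAdicSelmerData

open Literature.NumberTheory.EllipticCurves.ZpExtension (eisensteinLevel)

section Ramified

variable {K : Type u} [Field K] [NumberField K] {V : WeierstrassCurve K} [V.IsElliptic] {p : ℕ} [hp : Fact p.Prime]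
  {κ : ZpExtension K p} {γ : absoluteGaloisGroup K} (D : V.LambdaAdicSelmerData κ γ) {m : ℕ} (hm : 1 ≤ m)
  (t : ∀ k, (V.torsionGaloisModule ((p : ℤ) ^ (k + 1))).toContRepresentation →ⁱL
    (V.torsionGaloisModule ((p : ℤ) ^ k)).toContRepresentation)
  (ht : ∀ k (P : geomTorsion V ((p : ℤ) ^ (k + 1))), t k P = V.geomTorsionReduce p k P)
  (I : ZpExtension.EisensteinH1Data (κ.unitTwist (-1)) (fun k ↦ V.torsionGaloisModule ((p : ℤ) ^ k)) t hm)

include ht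

/-- **`f(𝔖_p(K_∞)) ⊆ H¹_{F_𝔮}(K, T_𝔮)` when every place above `p` ramifies in `K_∞`** (Howard, Lemma 2.2.7 / Prop. 2.2.8, the
containment): `toEisensteinH1Linear_mem_ordinarySelmer` with its uniformity hypothesis supplied by
`ZpExtension.exists_pow_mul_mem_comap_layerSubgroup_of_apply_ne_one` from a local inertia element acting non-trivially on `K_∞`.
[cite: Howard2004HeegnerKolyvagin, §2.2 Lemma 2.2.7 and Prop. 2.2.8] [cite: GreenbergLNM1716, §2 Props. 2.1–2.4]
[cite: Washington1997, §13.1] -/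
theorem toEisensteinH1Linear_mem_ordinarySelmer_of_ramified (hγ : κ.IsTopGenerator γ)
    (hE : ∀ P : V.toAffine.Point, p • P = 0 → P = 0) (S : Finset (HeightOneSpectrum (𝓞 K)))
    (hS : ∀ v ∈ V.badPlaces (𝓞 K), v ∈ S) (s : D.S)
    (hgood : ∀ v : HeightOneSpectrum (𝓞 K), (p : 𝓞 K) ∈ v.asIdeal → V.HasGoodReductionAt v)
    (hord : ∀ v : HeightOneSpectrum (𝓞 K), (p : 𝓞 K) ∈ v.asIdeal → ¬ ((p : ℤ) ∣ V.frobeniusTraceAt v))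
    (hram : ∀ v : HeightOneSpectrum (𝓞 K), (p : 𝓞 K) ∈ v.asIdeal →
      ∃ τ ∈ absInertia (v.adicCompletion K), κ (absGaloisRestrict K (v.adicCompletion K) τ) ≠ 1) :
    D.toEisensteinH1Linear hm t ht I hγ hE s ∈ I.ordinarySelmer S (fun v _ ↦ V.ordinaryFiltrationAt v t ht) :=
  D.toEisensteinH1Linear_mem_ordinarySelmer hm t ht I hγ hE S hS s hgood hord fun v hv ↦ by
    obtain ⟨τ, hτ, hne⟩ := hram v hv
    exact κ.exists_pow_mul_mem_comap_layerSubgroup_of_apply_ne_one hτ hne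

end Ramified

section Anticyclotomic

variable {K : Type} [Field K] [NumberField K] {V : WeierstrassCurve K} [V.IsElliptic] {p : ℕ} [hp : Fact p.Prime]
  {κ : ZpExtension K p} {γ : absoluteGaloisGroup K} (D : V.LambdaAdicSelmerData κ γ) {m : ℕ} (hm : 1 ≤ m)
  (t : ∀ k, (V.torsionGaloisModule ((p : ℤ) ^ (k + 1))).toContRepresentation →ⁱL
    (V.torsionGaloisModule ((p : ℤ) ^ k)).toContRepresentation)
  (ht : ∀ k (P : geomTorsion V ((p : ℤ) ^ (k + 1))), t k P = V.geomTorsionReduce p k P)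
  (I : ZpExtension.EisensteinH1Data (κ.unitTwist (-1)) (fun k ↦ V.torsionGaloisModule ((p : ℤ) ^ k)) t hm)

include ht

/-- **Howard's setting: `f(𝔖) ⊆ H¹_{F_𝔮}(K, T_𝔮)` for the anticyclotomic `ℤ_p`-extension of an imaginary quadratic field**
(`p` odd, `E` with good ordinary reduction at the places above `p`, `E(K)[p] = 0`): for every `s ∈ 𝔖_p(K_∞)` and every finite
`S ⊇ badPlaces`, `f s` lies in Howard's Selmer module `H¹_{F_𝔮}(K, T_𝔮)` (`EisensteinH1Data.ordinarySelmer` with the ordinary data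
`V.ordinaryFiltrationAt` at `v ∣ p`) — the containment of Howard, *Compos. Math.* 140 (2004), Lemma 2.2.7 / Prop. 2.2.8, as a
kernel theorem (the ramification of the places above `p` in `K_∞⁻` — Brink 2007, Cor. 1 — supplies the uniformity at `p`).
[cite: Howard2004HeegnerKolyvagin, §2.2 Lemma 2.2.7 and Prop. 2.2.8] [cite: Brink2007, Cor. 1 (p. 2136)]
[cite: GreenbergLNM1716, §2 Props. 2.1–2.4] -/
theorem toEisensteinH1Linear_mem_ordinarySelmer_of_isAnticyclotomic (hK : IsImaginaryQuadratic K) (hp2 : p ≠ 2)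
    (hκ : κ.IsAnticyclotomic) (hγ : κ.IsTopGenerator γ) (hE : ∀ P : V.toAffine.Point, p • P = 0 → P = 0)
    (S : Finset (HeightOneSpectrum (𝓞 K))) (hS : ∀ v ∈ V.badPlaces (𝓞 K), v ∈ S) (s : D.S)
    (hgood : ∀ v : HeightOneSpectrum (𝓞 K), (p : 𝓞 K) ∈ v.asIdeal → V.HasGoodReductionAt v)
    (hord : ∀ v : HeightOneSpectrum (𝓞 K), (p : 𝓞 K) ∈ v.asIdeal → ¬ ((p : ℤ) ∣ V.frobeniusTraceAt v)) :
    D.toEisensteinH1Linear hm t ht I hγ hE s ∈ I.ordinarySelmer S (fun v _ ↦ V.ordinaryFiltrationAt v t ht) :=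
  D.toEisensteinH1Linear_mem_ordinarySelmer hm t ht I hγ hE S hS s hgood hord fun _ hv ↦
    κ.exists_pow_mul_mem_comap_layerSubgroup_of_isAnticyclotomic hK hp2 hκ hv

end Anticyclotomic

end WeierstrassCurve.LambdaAdicSelmerData

end
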